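import Summits.Ventures.PercRepro.RankLevelSetLevelFiveCqTwelve
import Summits.Ventures.PercRepro.S2RowStep
import Summits.Ventures.PercRepro.S2LPRow10
import Summits.Ventures.PercRepro.S2LPRow9
import Summits.Ventures.PercRepro.S2LPRow8
import Summits.Ventures.PercRepro.Night2SevenFiveUnconditional
import Summits.Ventures.PercRepro.S2FiveWindow

/-!
# PercRepro — THE LAST FOUR RUNGS OF THE LEVEL-5 LADDER: THEOREM C₅ AT EVERY `p ≥ 11`, `≥ 10`, `≥ 9`, `≥ 8`, AND SUB-CLAIM S2 (p7, gen 20)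

The rows `p = 10`, `9`, `8` of the `e`-free core at every corank `d ≥ 6` are p2's row dispatchers `S2LP.c025_core_five_row_{ten, nine, eight}`
(S2LPRow10 / S2LPRow9 / S2LPRow8: the LP-certificate wrappers `c025_core_five_<p>_<d>` on the LP range, p1's hyperplane key beyond); the row
`p = 7` is night-2's `Star.rls_seven_five_unconditional` (every finite matroid). With the row step `c025_five_large_of_rows` (S2RowStep) and
Theorem C₅ at `12` (`c025_five_large_sharp12`, RankLevelSetLevelFiveCqTwelve), each rung is the row step on its two rows:
**`c025_five_large_sharp11`**, **`c025_five_large_sharp10`**, **`c025_five_large_sharp9`**, **`c025_five_large_sharp8 (M) [M.Finite] (p) (hp : 8 ≤ p) :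
RLS M p 5`**. Hence **`s2_window_holds : S2.S2Window`** — SUB-CLAIM S2: `RLS M p 5` for every finite matroid and every `7 ≤ p ≤ 834` — and the
whole level-`5` row **`c025_five_all (M) [M.Finite] (p) (hp : 7 ≤ p) : RLS M p 5`** (with `S2.rls_five_all_of_s2`). No window move is claimed
here (the lead's). Axioms: standard.
-/

open scoped Matroid

namespace PercRepro

namespace ThmN

variable {α : Type}

/-- **The whole `p = 10` row for cores** (p2's dispatcher in S2's form). -/
theorem c025_core_five_ten_all (M : Matroid α) [M.Finite]
    (hR : M.eRank = ((10 : ℕ) : ℕ∞)) (hbig : 10 + 5 < M.E.ncard)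
    (hfree : ∀ e ∈ M.E, ∃ A ⊆ M.E \ {e}, e ∉ M.closure A ∧ e ∉ M.closure ((M.E \ {e}) \ A)) : RLS M 10 5 :=
  S2LP.c025_core_five_row_ten M hR hfree (by omega)

/-- **The whole `p = 9` row for cores** (p2's dispatcher in S2's form). -/
theorem c025_core_five_nine_all (M : Matroid α) [M.Finite]
    (hR : M.eRank = ((9 : ℕ) : ℕ∞)) (hbig : 9 + 5 < M.E.ncard)
    (hfree : ∀ e ∈ M.E, ∃ A ⊆ M.E \ {e}, e ∉ M.closure A ∧ e ∉ M.closure ((M.E \ {e}) \ A)) : RLS M 9 5 :=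
  S2LP.c025_core_five_row_nine M hR hfree (by omega)

/-- **The whole `p = 8` row for cores** (p2's dispatcher in S2's form). -/
theorem c025_core_five_eight_all (M : Matroid α) [M.Finite]
    (hR : M.eRank = ((8 : ℕ) : ℕ∞)) (hbig : 8 + 5 < M.E.ncard)
    (hfree : ∀ e ∈ M.E, ∃ A ⊆ M.E \ {e}, e ∉ M.closure A ∧ e ∉ M.closure ((M.E \ {e}) \ A)) : RLS M 8 5 :=
  S2LP.c025_core_five_row_eight M hR hfree (by omega)

/-- **The whole `p = 7` row for cores** — night-2's theorem for every finite matroid. -/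
theorem c025_core_five_seven_all (M : Matroid α) [M.Finite]
    (_hR : M.eRank = ((7 : ℕ) : ℕ∞)) (_hbig : 7 + 5 < M.E.ncard)
    (_hfree : ∀ e ∈ M.E, ∃ A ⊆ M.E \ {e}, e ∉ M.closure A ∧ e ∉ M.closure ((M.E \ {e}) \ A)) : RLS M 7 5 := by
  haveI := Classical.decEq α
  exact Star.rls_seven_five_unconditional M

/-- **THEOREM C₅ AT EVERY `p ≥ 11`** (the row step on the rows `10` and `11`). -/
theorem c025_five_large_sharp11 (M : Matroid α) [M.Finite] (p : ℕ) (hp : 11 ≤ p) : RLS M p 5 :=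
  c025_five_large_of_rows 11 (by norm_num)
    (fun M _ hR hbig hfree => c025_core_five_ten_all M hR hbig hfree)
    (fun M _ hR hbig hfree => c025_core_five_eleven_all M hR hbig hfree)
    (fun M _ p hp => c025_five_large_sharp12 M p hp) M p hp

/-- **THEOREM C₅ AT EVERY `p ≥ 10`** (the row step on the rows `9` and `10`). -/
theorem c025_five_large_sharp10 (M : Matroid α) [M.Finite] (p : ℕ) (hp : 10 ≤ p) : RLS M p 5 :=
  c025_five_large_of_rows 10 (by norm_num)
    (fun M _ hR hbig hfree => c025_core_five_nine_all M hR hbig hfree)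
    (fun M _ hR hbig hfree => c025_core_five_ten_all M hR hbig hfree)
    (fun M _ p hp => c025_five_large_sharp11 M p hp) M p hp

/-- **THEOREM C₅ AT EVERY `p ≥ 9`** (the row step on the rows `8` and `9`). -/
theorem c025_five_large_sharp9 (M : Matroid α) [M.Finite] (p : ℕ) (hp : 9 ≤ p) : RLS M p 5 :=
  c025_five_large_of_rows 9 (by norm_num)
    (fun M _ hR hbig hfree => c025_core_five_eight_all M hR hbig hfree)
    (fun M _ hR hbig hfree => c025_core_five_nine_all M hR hbig hfree)
    (fun M _ p hp => c025_five_large_sharp10 M p hp) M p hp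

/-- **THEOREM C₅ AT EVERY `p ≥ 8`** (the row step on the rows `7` and `8`). -/
theorem c025_five_large_sharp8 (M : Matroid α) [M.Finite] (p : ℕ) (hp : 8 ≤ p) : RLS M p 5 :=
  c025_five_large_of_rows 8 (by norm_num)
    (fun M _ hR hbig hfree => c025_core_five_seven_all M hR hbig hfree)
    (fun M _ hR hbig hfree => c025_core_five_eight_all M hR hbig hfree)
    (fun M _ p hp => c025_five_large_sharp9 M p hp) M p hp

/-- **SUB-CLAIM S2 HOLDS**: `RLS M p 5` for every finite matroid and every `7 ≤ p ≤ 834` (the row `p = 7` is night-2's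
`Star.rls_seven_five_unconditional`, every `p ≥ 8` is Theorem C₅ at `8`). -/
theorem s2_window_holds : S2.S2Window := by
  intro α M _ p hp _
  rcases Nat.lt_or_ge p 8 with h | h
  · have hp' : p = 7 := by omega
    subst hp'
    haveI := Classical.decEq α
    exact Star.rls_seven_five_unconditional M
  · exact c025_five_large_sharp8 M p h

/-- **THE LEVEL-`5` ROW OF C-025**: `RLS M p 5` for every finite matroid and every `p ≥ 7`. -/
theorem c025_five_all (M : Matroid α) [M.Finite] (p : ℕ) (hp : 7 ≤ p) : RLS M p 5 :=
  S2.rls_five_all_of_s2 s2_window_holds M p hp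

end ThmN

end PercRepro
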